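import Literature.NumberTheory.EllipticCurves.Sprung2012.SharpFlatKatoDivisibility
import HarnessLib

/-!
# Sprung's ♯/♭ main conjecture (J. Number Theory 132 (2012), Main Conjecture 1.3 = 7.21 at `η = 1`)
# and its Eisenstein half, on Sprung's REAL `X^•(E/ℚ_∞)` — OPEN named conjectures, filed as
# obligation nodes (`@[conjecture] def`), nothing asserted

STAGED by the cross-ladder LITERATURE-TYPING layer (D-0088(4), cell `bsd-littype`, seat
`bsd-littype-11` g3) for a PLANNER to file under `Summits/BirchSwinnertonDyer/BirchSwinnertonDyer/
Theorems/` with an item (`--kind statement`); literature seats cannot file under `Theorems/`. An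
unproven conjecture is NOT Literature. This leaf is the ♯/♭ twin, binder for binder, of
`Summit.BirchSwinnertonDyer.Rank1Residual.Supersingular.KobayashiMainConjecture W p ε` /
`KobayashiLowerDivisibility W p ε` (the `a_p = 0` case: ♯ = Kobayashi's `−`, ♭ = Kobayashi's `+`),
now statable because Sprung's objects are tree vocabulary (cell `bsd-ssimc`, seat kdot-split g2:
`Sprung2012/ColemanMaps.lean`, `SharpFlatSelmer.lean` — `Sprung2012.SharpFlatSelmerDualData W κ γ ι ap g c •`
= `X^•(E/K_∞)` of Def. 7.11; `ColemanMapTheorems.lean` — `thm22_exists_isHondaSystem`) and the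
Kato half is a named fact (`Sprung2012.thm716_sharpFlatCharIdeal_divisibility`, seat bsd-littype-11,
file `Sprung2012/SharpFlatKatoDivisibility.lean`).

## Source, verbatim (held text `paper:doi-10-1016-j-jnt-2011-11-003`; ♯/♭ glyphs and «≠» restored from
## the clean-glyph TeX arXiv:0903.3419v1 / arXiv:1106.1936, see `SharpFlatKatoDivisibility.lean`)

p. 1486 [p0004 L33–L44]: "**Main Conjecture 1.3.** Let `p` be odd, and `∗ ∈ {♯, ♭}` so that
`L^∗_p(E, X)` is nonzero. The characteristic ideal of the Pontryagin dual of `Sel^∗(E/ℚ_∞)` is then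
generated by the `p`-adic `L`-function `L^∗_p(E, X)`: `Char(X^∗(E/ℚ_∞)) = (L^∗_p(E, X))`."
p. 1505 [p0023 L31–L60]: "In view of Proposition 7.19, the following conjecture is equivalent to the
main conjecture of Kato, and to that of Perrin-Riou [PR]: **Main Conjecture 7.21.** Let `p` be an odd
supersingular prime, and choose `∗ ∈ {♯, ♭}` so that `L^∗_p(E, η, X) ≠ 0`. In Theorem 7.16, `n = 0`
and the three inclusions are three equalities: `Char X^∗(E/K_∞)^η = ((1/X) L^∗_p(E, η, X))` if
`∗ = ♯`, `η ≠ 1`, and `a_p = 0`, `Char X^∗(E/K_∞)^η = (L^∗_p(E, η, X))` for all other cases." At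
`η = 1` (the `ℚ_∞`-objects the tree transcribes) the second clause applies for both colours and every
supersingular `a_p` — NO `1/X`. Status in print: OPEN at `a_p ≠ 0` (for `E/ℚ`: `p = 3`, `a_3 = ±3`);
Sprung, Adv. Math. 449 (2024) Thm. 1.1 proves it for square-free `N` CONDITIONALLY on his Conjecture
3.33 (two-variable Beilinson–Flach classes); at `a_p = 0` it is Kobayashi's conjecture (Pollack–Rubin:
CM; Burungale–Skinner–Tian–Wan arXiv:2409.01350 Thm. 1.3: semistable, announced, PRE).

## Transcription (tree vocabulary only)

Setting = `Sprung2012.thm716_sharpFlatCharIdeal_divisibility`'s, i.e. kdot-split's binder `hdiv` of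
`Theorems/SignedLowerHalvesSprungLowerHalfAtThreeKDotSplitReal.lean` word for word: globally minimal
`W` (`a_p = W.frobeniusTrace p`), the cyclotomic `ℤ_p`-extension `κ` with topological generator `γ`
matching the cyclotomic variable, the place `v ∣ p`, a local lift `g` of `γ`, a Honda system
`(cneg, c)` (the DATA through which `X^•` is defined), the newform `f` of `W` at any level `N`, the
period ratio `ϖ` (`ϖ · Ω_E = Ω⁺_f`, so that `ϖ · L^•` is Sprung's Néron-normalised function — exactly
as `KobayashiMainConjecture`), every Sprung pair `(L♯, L♭)` (`Sprung2017.IsSprungPair`, unique at a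
supersingular prime) with `L^• ≠ 0` ("`∗` so that `L^∗_p` is nonzero"), every dual datum `D`:
`X^• = D.X` is `Λ`-torsion and `char X^• = (g)` with `ι g = ϖ · ι L^•` in `ℚ_p⟦T⟧`
(`ι = iwasawaToPowerSeries p`). Odd `p` and supersingularity are hypotheses of the consumers (X8:
`p = 3`, `3 ∣ a_3`), as for `KobayashiMainConjecture`. NOT transcribed: `η ≠ 1`; `p = 2`.

## Contents (two `@[conjecture]` defs; kernel edges live in `SprungSharpFlatMainConjectureEdges.lean`)

* `SprungSharpFlatMainConjecture W p •` — Main Conj. 1.3 / 7.21 (`η = 1`) for `(E, p, •)`;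
* `SprungSharpFlatLowerDivisibility W p •` — its Eisenstein half «`ϖ L^•` divides a generator of
  `char X^•`» = the (MC↓•) displayed by crux 5 of route `SignedLowerHalves` (kdot-split's `hdiv`).
-/

set_option linter.dupNamespace false
set_option autoImplicit false

noncomputable section

open scoped Classical NumberField MatrixGroups ModularForm

open NumberField IsDedekindDomain CongruenceSubgroup WeierstrassCurve
  Literature.NumberTheory.EllipticCurves Literature.NumberTheory.EllipticCurves.ModularForms
  Literature.NumberTheory.EllipticCurves.ZpExtension Literature.NumberTheory.EllipticCurves.Sprung2017
  Literature.NumberTheory.EllipticCurves.Sprung2012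

namespace Summit.BirchSwinnertonDyer.BirchSwinnertonDyer.Theorems

universe u

/-- **Sprung's ♯/♭ main conjecture for `(E, p, •)`, Néron normalisation (Sprung 2012 Main Conj. 1.3 =
Main Conj. 7.21 at `η = 1`; OPEN — nothing asserted).** "Let `p` be odd, and `∗ ∈ {♯, ♭}` so that
`L^∗_p(E, X)` is nonzero. The characteristic ideal of the Pontryagin dual of `Sel^∗(E/ℚ_∞)` is then
generated by the `p`-adic `L`-function `L^∗_p(E, X)`: `Char(X^∗(E/ℚ_∞)) = (L^∗_p(E, X))`."
Transcription (module docstring): in the setting of `Sprung2012.thm716_sharpFlatCharIdeal_divisibility`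
(cyclotomic `(κ, γ)` with `IsCyclotomicVariable p γ`, place `v ∣ p`, local lift `g`, Honda system
`(cneg, c)`), for the newform `f` of `W`, the period ratio `ϖ` (`ϖ · Ω_E = Ω⁺_f`), EVERY Sprung pair
`(L♯, L♭)` with `L^• ≠ 0` and EVERY dual datum `D` of `Sel^•(E/ℚ_∞)`
(`Sprung2012.SharpFlatSelmerDualData`): `D.X` is `Λ`-torsion and `D.charIdeal = (g)` with
`ι g = ϖ · ι L^•`. The ♯/♭ twin of `Supersingular.KobayashiMainConjecture W p ε`. Known: `⊇` up to `pⁿ`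
(`Sprung2012.thm716_…`, Kato); OPEN at `a_p ≠ 0`; Sprung 2024 Thm. 1.1 = this for square-free `N`
GIVEN his Conj. 3.33. An obligation node. [cite: Sprung2012, Main Conj. 1.3 (p. 1486) and Main Conj. 7.21 (p. 1505)] -/
@[conjecture] def SprungSharpFlatMainConjecture (W : WeierstrassCurve ℚ) [W.IsElliptic]
    [W.IsGloballyMinimal] (p : ℕ) [Fact p.Prime] (col : Chroma) : Prop :=
  ∀ (κ : ZpExtension ℚ p) (γ : Field.absoluteGaloisGroup ℚ),
      κ.IsCyclotomic → κ.IsTopGenerator γ → IsCyclotomicVariable p γ →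
    ∀ (v : HeightOneSpectrum (𝓞 ℚ)), (p : 𝓞 ℚ) ∈ v.asIdeal →
    ∀ (g : Field.absoluteGaloisGroup (v.adicCompletion ℚ)),
      κ.IsTopGenerator (resGalOfEmb (closureEmb (K := ℚ) (v.adicCompletion ℚ)) g) →
    ∀ (cneg : localPoints W (v.adicCompletion ℚ)) (c : ℕ → localPoints W (v.adicCompletion ℚ)),
      IsHondaSystem κ (closureEmb (K := ℚ) (v.adicCompletion ℚ)) W (W.frobeniusTrace p) g cneg c →
    ∀ (N : ℕ) (_ : NeZero N) (f : CuspForm (Gamma0 N) 2) (ϖ : ℚ) (Lsharp Lflat : IwasawaAlgebra p),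
      IsNewformOf W f → (ϖ : ℝ) * W.realPeriodRat = plusPeriod f →
      IsSprungPair f p (W.frobeniusTrace p) Lsharp Lflat → chromaticL col Lsharp Lflat ≠ 0 →
    ∀ D : SharpFlatSelmerDualData W κ γ (closureEmb (K := ℚ) (v.adicCompletion ℚ))
        (W.frobeniusTrace p) g c col,
      Module.IsTorsion (IwasawaAlgebra p) D.X ∧
      ∃ gen : IwasawaAlgebra p, D.charIdeal = Ideal.span {gen} ∧
        iwasawaToPowerSeries p gen =
          PowerSeries.C (ϖ : ℚ_[p]) * iwasawaToPowerSeries p (chromaticL col Lsharp Lflat)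

/-- **The Eisenstein half (MC↓•) of Sprung's ♯/♭ main conjecture for `(E, p, •)`** (OPEN — nothing
asserted): in the setting of `SprungSharpFlatMainConjecture W p •`, the Néron-normalised `ϖ · L^•`
DIVIDES a generator of `char X^•(E/ℚ_∞)`: `D.charIdeal = (g)` with `ι g = ϖ · ι(L^• · h)` for some
`h ∈ Λ` — the divisibility that bounds Selmer from BELOW; the converse inclusion is the THEOREM
`Sprung2012.thm716_sharpFlatCharIdeal_divisibility` (Kato, up to `pⁿ`; `n = 0` under
`GL_{ℤ_p}`-surjectivity). For ONE colour with `L^• ≠ 0` this is the displayed hypothesis `hdiv` of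
`Theorems.…KDotSplitReal.chromaticDivisibility_of_sharpFlatLowerDivisibility` (route
`SignedLowerHalves`, crux `SprungLowerHalfAtThree`, class X8 = `(3, a_3 = ±3)`, rank 0). The ♯/♭ twin of
`Supersingular.KobayashiLowerDivisibility W p ε`. An obligation node.
[cite: Sprung2012, Main Conj. 1.3 (p. 1486), Main Conj. 7.21 (p. 1505) and Thm. 7.16 (p. 1504)] -/
@[conjecture] def SprungSharpFlatLowerDivisibility (W : WeierstrassCurve ℚ) [W.IsElliptic]
    [W.IsGloballyMinimal] (p : ℕ) [Fact p.Prime] (col : Chroma) : Prop :=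
  ∀ (κ : ZpExtension ℚ p) (γ : Field.absoluteGaloisGroup ℚ),
      κ.IsCyclotomic → κ.IsTopGenerator γ → IsCyclotomicVariable p γ →
    ∀ (v : HeightOneSpectrum (𝓞 ℚ)), (p : 𝓞 ℚ) ∈ v.asIdeal →
    ∀ (g : Field.absoluteGaloisGroup (v.adicCompletion ℚ)),
      κ.IsTopGenerator (resGalOfEmb (closureEmb (K := ℚ) (v.adicCompletion ℚ)) g) →
    ∀ (cneg : localPoints W (v.adicCompletion ℚ)) (c : ℕ → localPoints W (v.adicCompletion ℚ)),
      IsHondaSystem κ (closureEmb (K := ℚ) (v.adicCompletion ℚ)) W (W.frobeniusTrace p) g cneg c →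
    ∀ (N : ℕ) (_ : NeZero N) (f : CuspForm (Gamma0 N) 2) (ϖ : ℚ) (Lsharp Lflat : IwasawaAlgebra p),
      IsNewformOf W f → (ϖ : ℝ) * W.realPeriodRat = plusPeriod f →
      IsSprungPair f p (W.frobeniusTrace p) Lsharp Lflat → chromaticL col Lsharp Lflat ≠ 0 →
    ∀ D : SharpFlatSelmerDualData W κ γ (closureEmb (K := ℚ) (v.adicCompletion ℚ))
        (W.frobeniusTrace p) g c col,
      ∃ gen h : IwasawaAlgebra p, D.charIdeal = Ideal.span {gen} ∧
        iwasawaToPowerSeries p gen =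
          PowerSeries.C (ϖ : ℚ_[p]) * iwasawaToPowerSeries p (chromaticL col Lsharp Lflat * h)

end Summit.BirchSwinnertonDyer.BirchSwinnertonDyer.Theorems

end
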